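import Literature.MathematicalPhysics.KineticTheory.IllnerPulvirentiGCSeriesBounds
import Literature.MathematicalPhysics.KineticTheory.IllnerPulvirentiAssembly
import Literature.MathematicalPhysics.KineticTheory.HardSphereBBGKYLiouvilleFlow
import Literature.Analysis.FluidPDE.HardSphereFlowMeasurable
import HarnessLib

/-!
# The grand-canonical BBGKY hierarchy of hard spheres on `ℝ^d` along arbitrary flows, with
# canonical boundary values: the model, the measurability of its Duhamel terms, and the reduction
# of Illner–Pulvirenti's theorem to the identification and the term-by-term convergence

Topic: MathematicalPhysics / KineticTheory. A brick of the BBGKY side of the named fact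
`Literature.MathematicalPhysics.KineticTheory.illner_pulvirenti` (**hilbert6.S03**;
Cercignani–Illner–Pulvirenti 1994 Thm 4.5.1; Illner–Pulvirenti 1986/1989), the sequel of
`IllnerPulvirentiLiftedTransport` and `IllnerPulvirentiGCSeriesBounds`, and the `ℝ^d` counterpart
of `LanfordGCHierarchy` (hilbert6.S02 on `T^d`).

The honest, everywhere-defined Duhamel terms of the grand-canonical BBGKY hierarchy of the rare
cloud on `ℝ^d` (CIP 1994 (4.7) in grand-canonical form) are built from: the lifted good-set
transports `T_m(t) g = boundaryLift G ε m (1_{good} · g ∘ Φ^m_{-t})` along GIVEN hard-sphere flows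
`Φ m` (canonical boundary values of `Literature.Analysis.FluidPDE.incomingLift`, CIP (4.3.4), as in
the physical hierarchy `MildBBGKYae`); the operators `∑_i C^i_{m,m+1,ε}` (`μ_ε ε^{d-1} = 1`); and
the initial rescaled correlation functions `F₀^{(m)} = correlationFn μ (gcInitial G ε μ f₀) m`.
Their global majorants are `abs_gcDuhamelTerm_le_global` (`IllnerPulvirentiGCSeriesBounds`). This
file supplies their MEASURABILITY, by exhibiting them as Duhamel terms of an abstract hierarchy
(`Kinetic.HierarchyModel` of `HierarchyDuhamelBlocks`), and closes the bookkeeping: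

* `incomingRep G ε s` (§1) — the incoming representative map of configurations with
  `boundaryLift G ε s f = f ∘ incomingRep G ε s` (`boundaryLift_apply`); it fixes positions and
  energy and is measurable for a measurable geometry (`measurable_incomingRep`: a finite nested
  `ite` over the least qualifying index, `Fin.find_eq_iff`).
* `liftedGCModel ε Φ` (§2) — **the grand-canonical BBGKY hierarchy on `ℝ^d` along the flows `Φ`
  as a `HierarchyModel`**: flows `W ↦ good.piecewise (Φ^m_t) id (incomingRep W)` (jointly
  measurable by `HardSphereFlow.measurable_piecewise_flow`, energy-preserving), operators
  `1_{good} · ∑_i C^i_{m,m+1,ε}`, `opConst = C_d = J_d |S^{d-1}|`; and the identities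
  `T_m(t) g = S'_m(t) (1_{good} g)` (`liftedTransport_eq_model`) and
  `Q^{T,C}_{s,s+n}(t) F₀ = Q^{M'}_{s,s+n}(t) (1_{good} F₀)` (`liftedDuhamelTerm_eq_model`). No group
  law is claimed (none is needed for Duhamel terms).
* `measurable_correlationFn_gcInitial_euclidean`, `isNice_indicator_correlationFn_gcInitial`,
  `measurable_gcDuhamelTerm` (§3) — the data are nice, hence (`isNice_duhamelTerm`) every Duhamel
  term `Q^ε_{s,s+n}(t) F₀` (`t ≥ 0`) is measurable.
* `illner_pulvirenti_of_gcSeries` (§4) — **the reduction of `illner_pulvirenti` to the two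
  remaining inputs on its own Duhamel series**: `illner_pulvirenti_of_bbgkySide`
  (`IllnerPulvirentiAssembly`) with `A_k^{(s),n}(t) := Q^{ε_k}_{s,s+n}(t) F_k(0)` built along
  hard-sphere flows `Ψ k` of the provider's choosing (the given flows, or reference flows agreeing
  with them a.e.) — measurability and the majorants `(1 + e^{s-1}) c^s 4^{-n} e^{-(β₀/2) E}`
  (threshold `4 c C_g ≤ 1`) being proved for any flows — so that the named fact follows from
  (a) the a.e. identification `∑_n Q^{ε_k}_{s,s+n}(t) F_k(0) = F_k^{(s)}(t)` with the correlation
  functions evolved by the given flows (the rigorous BBGKY hierarchy in `ℝ^d` and its iteration,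
  CIP Thm 4.3.1 / App. 4.A–4.B; Illner–Pulvirenti 1987) and (b) the term-by-term convergence in
  the sense of observables (CIP §4.4 Step 1; GST 2013 Part III), for data below a threshold, on
  every `[0, T]`.

Definitions with bodies (`incomingRep`, `liftedGCModel`) and theorems; no named fact.

## References

* C. Cercignani, R. Illner, M. Pulvirenti, *The Mathematical Theory of Dilute Gases*, Applied
  Mathematical Sciences 106, Springer (1994), §4.3 (4.3.4), Thm 4.3.1; §4.4 (4.7), Thm 4.4.1 Step 1;
  §4.5 Thm 4.5.1 and its proof, pp. 87–90; App. 4.A–4.B (held: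
  `lit read book:cercignani1994-mathematical-theory-dilute-gases`; bib key `CIP1994`).
* R. Illner, M. Pulvirenti, Comm. Math. Phys. 105 (1986) 189–203; 121 (1989) 143–146;
  *A derivation of the BBGKY hierarchy for hard sphere particle systems*, Transport Theory
  Statist. Phys. 16 (1987) 997–1012.
* I. Gallagher, L. Saint-Raymond, B. Texier, *From Newton to Boltzmann*, EMS (2013) =
  arXiv:1208.5753, (4.3.5)–(4.3.9), Part III (bib key `GST2013`).
* T. Bodineau, I. Gallagher, L. Saint-Raymond, S. Simonella, Ann. Math. 198 (2023) =
  arXiv:2008.10403, §1.1 (1.1.6)–(1.1.8) (bib key `BGSS2023`).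
-/

open MeasureTheory Metric Real Set Filter Topology Function
open scoped InnerProductSpace ENNReal

namespace Literature.MathematicalPhysics.KineticTheory

noncomputable section

open Literature.Analysis.FluidPDE

variable {d : Type*} [Fintype d]

/-! ## §1. The incoming representative of a configuration -/

section Rep

variable {X : Type*}

open scoped Classical in
/-- The *incoming representative map* underlying the canonical boundary version
`Literature.Analysis.FluidPDE.incomingLift` / `boundaryLift`: at a configuration of `k+1` particles in
which the added particle `k+1` is at distance `ε` from some `x_i` with incoming velocities, the
outgoing partner `collidePair i (k+1)` (least such `i`); elsewhere, and at level `0`, the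
configuration itself — so that `boundaryLift G ε s f = f ∘ incomingRep G ε s`
(`boundaryLift_apply`). This is the identification "`P(z) = P(z')`" of CIP 1994 (4.3.4) as a map
of configurations. [cite: CIP1994, §4.3 (4.3.4)] -/
def incomingRep (G : Geometry d X) (ε : ℝ) : (s : ℕ) → Config s d X → Config s d X
  | 0 => id
  | k + 1 => fun Z =>
      if h : ∃ i : Fin k, ‖G.sepVec (Z (Fin.castSucc i)).1 (Z (Fin.last k)).1‖ = ε ∧
          IsIncoming G Z (Fin.castSucc i) (Fin.last k) then
        collidePair G (Fin.castSucc (Fin.find _ h)) (Fin.last k) Z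
      else Z

variable (G : Geometry d X) (ε : ℝ)

/-- At level `0` the incoming representative is the identity. [folklore] -/
@[simp]
theorem incomingRep_zero_apply (Z : Config 0 d X) : incomingRep G ε 0 Z = Z := rfl

open scoped Classical in
/-- The incoming representative at level `k + 1`, unfolded. [folklore] -/
theorem incomingRep_succ_apply (k : ℕ) (Z : Config (k + 1) d X) :
    incomingRep G ε (k + 1) Z =
      if h : ∃ i : Fin k, ‖G.sepVec (Z (Fin.castSucc i)).1 (Z (Fin.last k)).1‖ = ε ∧
          IsIncoming G Z (Fin.castSucc i) (Fin.last k) then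
        collidePair G (Fin.castSucc (Fin.find _ h)) (Fin.last k) Z
      else Z := rfl

/-- **The canonical boundary version is composition with the incoming representative**:
`boundaryLift G ε s f Z = f (incomingRep G ε s Z)`. [folklore] -/
theorem boundaryLift_apply (s : ℕ) (f : Config s d X → ℝ) (Z : Config s d X) :
    boundaryLift G ε s f Z = f (incomingRep G ε s Z) := by
  cases s with
  | zero => rfl
  | succ k =>
    rw [boundaryLift_succ, incomingRep_succ_apply]
    unfold incomingLift
    split_ifs <;> rfl

/-- The incoming representative does not move the particles. [folklore] -/
@[simp]
theorem incomingRep_apply_fst (s : ℕ) (Z : Config s d X) (j : Fin s) :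
    (incomingRep G ε s Z j).1 = (Z j).1 := by
  cases s with
  | zero => rfl
  | succ k =>
    rw [incomingRep_succ_apply]
    split_ifs
    · exact collidePair_apply_fst Z j
    · rfl

/-- The incoming representative has the kinetic energy of the configuration. [folklore] -/
@[simp]
theorem configEnergy_incomingRep (s : ℕ) (Z : Config s d X) :
    configEnergy (incomingRep G ε s Z) = configEnergy Z := by
  cases s with
  | zero => rfl
  | succ k =>
    rw [incomingRep_succ_apply]
    split_ifs with h
    · exact configEnergy_collidePair (Fin.castSucc_lt_last _).ne Z
    · rfl

/-- A right fold of `if Q i then f i else ·` over a list with no index satisfying `Q` returns the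
seed. [folklore] -/
theorem foldr_ite_eq_self {α : Type*} {k : ℕ} (Q : Fin k → Prop) [DecidablePred Q] (f : Fin k → α)
    (a : α) (l : List (Fin k)) (h : ∀ i ∈ l, ¬ Q i) :
    l.foldr (fun i acc => if Q i then f i else acc) a = a := by
  induction l with
  | nil => rfl
  | cons i l ih =>
    rw [List.foldr_cons, if_neg (h i List.mem_cons_self)]
    exact ih fun j hj => h j (List.mem_cons_of_mem i hj)

/-- A right fold of `if Q i then f i else ·` over a list containing the unique index satisfying `Q`
returns `f` at that index. [folklore] -/
theorem foldr_ite_eq_of_mem {α : Type*} {k : ℕ} (Q : Fin k → Prop) [DecidablePred Q] (f : Fin k → α)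
    (a : α) (l : List (Fin k)) {i₀ : Fin k} (hi₀ : i₀ ∈ l) (hQ : Q i₀)
    (huniq : ∀ i, Q i → i = i₀) :
    l.foldr (fun i acc => if Q i then f i else acc) a = f i₀ := by
  induction l with
  | nil => exact absurd hi₀ List.not_mem_nil
  | cons i l ih =>
    rw [List.foldr_cons]
    by_cases hi : Q i
    · rw [if_pos hi, huniq i hi]
    · rw [if_neg hi]
      rcases List.mem_cons.1 hi₀ with h | h
      · exact absurd (h ▸ hQ) hi
      · exact ih h

variable {G ε}

/-- **The incoming representative map is measurable** (for a measurable geometry): on the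
measurable set where `i` is the least index with `|x_i - x_{k+1}| = ε` and incoming velocities it
is the measurable map `collidePair i (k+1)`, and these finitely many sets together with the
complement of their union partition the phase space (a finite nested `ite`,
`foldr_ite_eq_of_mem` / `foldr_ite_eq_self`). [folklore] -/
theorem measurable_incomingRep [MeasurableSpace X] (hG : G.IsMeasurable) (s : ℕ) :
    Measurable (incomingRep G ε s) := by
  cases s with
  | zero => exact measurable_id
  | succ k =>
    classical
    -- the predicate, its least-index version and their measurability
    obtain ⟨P, hP⟩ : ∃ P : Fin k → Config (k + 1) d X → Prop, P = fun i Z =>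
        ‖G.sepVec (Z (Fin.castSucc i)).1 (Z (Fin.last k)).1‖ = ε ∧
          IsIncoming G Z (Fin.castSucc i) (Fin.last k) := ⟨_, rfl⟩
    have hPm : ∀ i, MeasurableSet {Z | P i Z} := fun i => by
      rw [hP]
      exact (measurableSet_eq_fun (hG.measurable_sepVec_config _ _).norm measurable_const).inter
        (hG.measurableSet_isIncoming _ _)
    have hQm : ∀ i, MeasurableSet {Z : Config (k + 1) d X | P i Z ∧ ∀ j < i, ¬ P j Z} := fun i => by
      have h1 : {Z : Config (k + 1) d X | P i Z ∧ ∀ j < i, ¬ P j Z} =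
          {Z | P i Z} ∩ ⋂ j : Fin k, {Z | j < i → ¬ P j Z} := by
        ext Z; simp
      rw [h1]
      refine (hPm i).inter (MeasurableSet.iInter fun j => ?_)
      by_cases hji : j < i
      · have h2 : {Z : Config (k + 1) d X | j < i → ¬ P j Z} = {Z | P j Z}ᶜ := by
          ext Z; simp [hji]
        rw [h2]
        exact (hPm j).compl
      · have h2 : {Z : Config (k + 1) d X | j < i → ¬ P j Z} = Set.univ := by
          ext Z; simp [hji]
        rw [h2]
        exact MeasurableSet.univ
    have huniq : ∀ (Z : Config (k + 1) d X) (i i' : Fin k), (P i Z ∧ ∀ j < i, ¬ P j Z) →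
        (P i' Z ∧ ∀ j < i', ¬ P j Z) → i = i' := by
      intro Z i i' hi hi'
      rcases lt_trichotomy i i' with hlt | heq | hgt
      · exact absurd hi.1 (hi'.2 i hlt)
      · exact heq
      · exact absurd hi'.1 (hi.2 i' hgt)
    -- the nested `ite`
    obtain ⟨F, hF⟩ : ∃ F : List (Fin k) → Config (k + 1) d X → Config (k + 1) d X, F = fun l Z =>
        l.foldr (fun i acc => if P i Z ∧ ∀ j < i, ¬ P j Z then
          collidePair G (Fin.castSucc i) (Fin.last k) Z else acc) Z :=
      ⟨_, rfl⟩
    have hFm : ∀ l, Measurable (F l) := by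
      intro l
      rw [hF]
      induction l with
      | nil => simpa using measurable_id'
      | cons i l ih =>
        simp only [List.foldr_cons]
        exact Measurable.ite (hQm i) (hG.measurable_collidePair _ _) ih
    have heq : incomingRep G ε (k + 1) = F (List.finRange k) := by
      funext Z
      rw [hF, incomingRep_succ_apply]
      beta_reduce
      split_ifs with h
      · have hfind : P (Fin.find _ h) Z ∧ ∀ j < Fin.find _ h, ¬ P j Z := by
          have := (Fin.find_eq_iff h).1 rfl
          rw [hP]
          exact this
        exact (foldr_ite_eq_of_mem (fun i => P i Z ∧ ∀ j < i, ¬ P j Z)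
          (fun i => collidePair G (Fin.castSucc i) (Fin.last k) Z) Z _ (List.mem_finRange _)
          hfind (fun i hi => huniq Z i _ hi hfind)).symm
      · refine (foldr_ite_eq_self (fun i => P i Z ∧ ∀ j < i, ¬ P j Z)
          (fun i => collidePair G (Fin.castSucc i) (Fin.last k) Z) Z _ fun i _ hi => h ?_).symm
        rw [hP] at hi
        exact ⟨i, hi.1⟩
    rw [heq]
    exact hFm _

end Rep

/-! ## §2. The grand-canonical BBGKY hierarchy on `ℝ^d` along arbitrary hard-sphere flows, as a
`HierarchyModel` -/

section Model

variable {ε : ℝ}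

open scoped Classical in
/-- **The grand-canonical BBGKY hierarchy of hard spheres of diameter `ε` on `ℝ^d`, along given
hard-sphere flows `Φ m` and with canonical boundary values, as a `HierarchyModel`**
(`HierarchyDuhamelBlocks`): the flows are `W ↦ Φ^m_t (ι W)` on configurations whose incoming
representative `ι W = incomingRep G ε m W` is good and fix the others (`good.piecewise (Φ^m_t) id`,
the jointly measurable device of `HardSphereFlow.measurable_piecewise_flow`); the collision operators
are `1_{good} · ∑_i C^i_{m,m+1,ε}` (the grand-canonical operator in the scaling `μ_ε ε^{d-1} = 1`,
restricted to the good set as every transported function is); `opConst = C_d = J_d |S^{d-1}|`.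
Its Duhamel terms applied to `1_{good} · F₀` are the Duhamel terms of the BBGKY series with the
lifted good-set transports `boundaryLift G ε m (1_{good} · hsTransport (Φ m) ·)` and the operators
`∑_i C^i_{m,m+1,ε}` (`liftedDuhamelTerm_eq_model`) — the series (4.7) of CIP 1994 for the rare
cloud, in grand-canonical form, on `ℝ^d`. No group law is claimed for these flows.
[cite: CIP1994, §4.4 (4.7) and §4.5] -/
def liftedGCModel (ε : ℝ) (Φ : (s : ℕ) → HardSphereFlow (Euclidean.geometry d) ε s) :
    HierarchyModel d (EuclideanSpace ℝ d) where
  flow := fun s t W => (Φ s).good.piecewise ((Φ s).flow t) id (incomingRep (Euclidean.geometry d) ε s W)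
  op := fun s g W => (Φ s).good.indicator
    (fun W => ∑ i : Fin s, hsCollisionTerm (Euclidean.geometry d) ε s i g W) W
  opConst := (∫ u : EuclideanSpace ℝ d, (1 + ‖u‖) * exp (-(1 / 2) * ‖u‖ ^ 2)) *
    (KineticTheory.sphereMeasure : Measure (sphere (0 : EuclideanSpace ℝ d) 1)).real univ
  configEnergy_flow := fun s t Z => by
    by_cases hZ : incomingRep (Euclidean.geometry d) ε s Z ∈ (Φ s).good
    · rw [Set.piecewise_eq_of_mem _ _ _ hZ, (Φ s).configEnergy_flow hZ, configEnergy_incomingRep]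
    · rw [Set.piecewise_eq_of_notMem _ _ _ hZ, id, configEnergy_incomingRep]
  measurable_flow := fun s =>
    (Φ s).measurable_piecewise_flow_comp continuous_euclidean_translate measurable_fst
      ((measurable_incomingRep Euclidean.isMeasurable_geometry s).comp measurable_snd)
  measurable_op := fun s u hu => by
    have hsum : Measurable fun p : ℝ × Config s d (EuclideanSpace ℝ d) =>
        ∑ i : Fin s, hsCollisionTerm (Euclidean.geometry d) ε s i (fun Z => u (p.1, Z)) p.2 :=
      Finset.measurable_sum _ fun i _ =>
        measurable_hsCollisionTerm_param Euclidean.isMeasurable_geometry.measurable_translate ε i hu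
    refine Measurable.ite ?_ hsum measurable_const
    exact measurable_snd (Φ s).measurableSet_good
  op_add := fun s g₁ g₂ h₁ h₂ => by
    funext W
    simp only [Pi.add_apply]
    by_cases hW : W ∈ (Φ s).good
    · simp only [Set.indicator_of_mem hW]
      rw [← Finset.sum_add_distrib]
      refine Finset.sum_congr rfl fun i _ => ?_
      have h := hsCollisionTerm_finset_sum Euclidean.isMeasurable_geometry.measurable_translate ε i
        (Finset.univ : Finset Bool) (g := fun b => bif b then g₁ else g₂)
        (fun b _ => by cases b <;> simp only [cond_true, cond_false] <;> first | exact h₁.1 | exact h₂.1)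
        (fun b _ => by cases b <;> simp only [cond_true, cond_false] <;> first | exact h₁.2 | exact h₂.2) W
      simpa [Fintype.sum_bool] using h
    · simp only [Set.indicator_of_notMem hW, add_zero]
  op_smul := fun s c g => by
    funext W
    simp only [Pi.smul_apply, smul_eq_mul]
    by_cases hW : W ∈ (Φ s).good
    · simp only [Set.indicator_of_mem hW, Finset.mul_sum]
      exact Finset.sum_congr rfl fun i _ => hsCollisionTerm_smul _ ε s i c g W
    · simp only [Set.indicator_of_notMem hW, mul_zero]
  opConst_nonneg := by
    haveI := isFiniteMeasure_sphereMeasure (E := EuclideanSpace ℝ d)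
    have hJ : 0 ≤ ∫ u : EuclideanSpace ℝ d, (1 + ‖u‖) * exp (-(1 / 2) * ‖u‖ ^ 2) :=
      integral_nonneg fun u => by positivity
    exact mul_nonneg hJ measureReal_nonneg
  op_weighted := fun k g K b hb hK hg Z => by
    set C := (∫ u : EuclideanSpace ℝ d, (1 + ‖u‖) * exp (-(1 / 2) * ‖u‖ ^ 2)) *
      (KineticTheory.sphereMeasure : Measure (sphere (0 : EuclideanSpace ℝ d) 1)).real univ with hC
    have hsum : |∑ i : Fin k, hsCollisionTerm (Euclidean.geometry d) ε k i g Z| ≤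
        C * (sqrt b ^ Fintype.card d)⁻¹ * (k * (sqrt b)⁻¹ + ∑ i, ‖(Z i).2‖) *
          (K * exp (-b * configEnergy Z)) := by
      calc |∑ i : Fin k, hsCollisionTerm (Euclidean.geometry d) ε k i g Z|
          ≤ ∑ i : Fin k, |hsCollisionTerm (Euclidean.geometry d) ε k i g Z| := Finset.abs_sum_le_sum_abs _ _
        _ ≤ ∑ i : Fin k, C * (sqrt b ^ Fintype.card d)⁻¹ * ((sqrt b)⁻¹ + ‖(Z i).2‖) *
              (K * exp (-b * configEnergy Z)) :=
            Finset.sum_le_sum fun i _ => abs_hsCollisionTerm_le_weighted _ ε i hb hg Z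
        _ = _ := by
            rw [← Finset.sum_mul, ← Finset.mul_sum, Finset.sum_add_distrib, Finset.sum_const,
              Finset.card_univ, Fintype.card_fin, nsmul_eq_mul]
    by_cases hZ : Z ∈ (Φ k).good
    · rw [Set.indicator_of_mem hZ]
      exact hsum
    · rw [Set.indicator_of_notMem hZ, abs_zero]
      exact (abs_nonneg _).trans hsum

variable (Φ : (s : ℕ) → HardSphereFlow (Euclidean.geometry d) ε s)

open scoped Classical in
/-- The flows of the model, unfolded. [folklore] -/
theorem liftedGCModel_flow (s : ℕ) (t : ℝ) (W : Config s d (EuclideanSpace ℝ d)) :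
    (liftedGCModel ε Φ).flow s t W =
      (Φ s).good.piecewise ((Φ s).flow t) id (incomingRep (Euclidean.geometry d) ε s W) := rfl

/-- The collision operators of the model, unfolded. [folklore] -/
theorem liftedGCModel_op (s : ℕ) (g : Config (s + 1) d (EuclideanSpace ℝ d) → ℝ)
    (W : Config s d (EuclideanSpace ℝ d)) :
    (liftedGCModel ε Φ).op s g W =
      (Φ s).good.indicator (fun W => ∑ i : Fin s, hsCollisionTerm (Euclidean.geometry d) ε s i g W) W :=
  rfl

/-- **The lifted good-set transport is the transport of the model applied to the good-set
restriction**: `boundaryLift G ε m (1_{good} · g ∘ Φ_{-t}) = S'_m(t) (1_{good} · g)`. [folklore] -/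
theorem liftedTransport_eq_model (m : ℕ) (t : ℝ) (g : Config m d (EuclideanSpace ℝ d) → ℝ) :
    boundaryLift (Euclidean.geometry d) ε m ((Φ m).good.indicator (hsTransport (Φ m) t g)) =
      (liftedGCModel ε Φ).transport m t ((Φ m).good.indicator g) := by
  classical
  funext W
  rw [boundaryLift_apply, HierarchyModel.transport_apply, liftedGCModel_flow]
  by_cases hY : incomingRep (Euclidean.geometry d) ε m W ∈ (Φ m).good
  · rw [Set.indicator_of_mem hY, hsTransport_apply, Set.piecewise_eq_of_mem _ _ _ hY,
      Set.indicator_of_mem ((Φ m).mapsTo_good (-t) hY)]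
  · rw [Set.indicator_of_notMem hY, Set.piecewise_eq_of_notMem _ _ _ hY, id,
      Set.indicator_of_notMem hY]

/-- **The Duhamel terms of the BBGKY series with lifted good-set transports and operators
`∑_i C^i_{m,m+1,ε}` are the Duhamel terms of the model `liftedGCModel` applied to the good-set
restriction of the data.** [folklore] -/
theorem liftedDuhamelTerm_eq_model (F₀ : GCState d (EuclideanSpace ℝ d)) (n : ℕ) :
    ∀ (s : ℕ) (t : ℝ),
      duhamelTerm (fun m t' g => boundaryLift (Euclidean.geometry d) ε m ((Φ m).good.indicator
          (hsTransport (Φ m) t' g)))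
        (fun m g W => ∑ i : Fin m, hsCollisionTerm (Euclidean.geometry d) ε m i g W) n s t F₀ =
      duhamelTerm (liftedGCModel ε Φ).transport (liftedGCModel ε Φ).op n s t
        (fun m => (Φ m).good.indicator (F₀ m)) := by
  induction n with
  | zero =>
    intro s t
    rw [duhamelTerm_zero, duhamelTerm_zero]
    exact liftedTransport_eq_model Φ s t (F₀ s)
  | succ n ih =>
    intro s t
    funext Z
    rw [duhamelTerm_succ, duhamelTerm_succ]
    refine intervalIntegral.integral_congr fun τ _ => ?_
    rw [ih (s + 1) τ, liftedTransport_eq_model Φ s (t - τ)]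
    rfl

end Model

/-! ## §3. The grand-canonical rare-cloud data and the measurability of the Duhamel terms -/

section Data

variable {ε : ℝ}

/-- Each sector of the grand-canonical Gibbs-type state of a measurable `f₀` on `ℝ^d` is
measurable. [folklore] -/
theorem measurable_gcInitial_euclidean (ε μ : ℝ) {f₀ : EuclideanSpace ℝ d × EuclideanSpace ℝ d → ℝ}
    (hf₀m : Measurable f₀) (N : ℕ) :
    Measurable (gcInitial (Euclidean.geometry d) ε μ f₀ N) := by
  unfold gcInitial
  exact ((measurable_tensorPow hf₀m N).indicator (measurableSet_hardSphereDomain _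
    Euclidean.measurable_geometry_sepVec N ε)).const_mul _

/-- **The rescaled correlation functions of the grand-canonical Gibbs-type state of a measurable
`f₀` on `ℝ^d` are measurable** (a countable series of measurable parametric integrals; as
`measurable_correlationFn_gcInitial` on `T^d`). [folklore] -/
theorem measurable_correlationFn_gcInitial_euclidean (ε μ : ℝ)
    {f₀ : EuclideanSpace ℝ d × EuclideanSpace ℝ d → ℝ} (hf₀m : Measurable f₀) (s : ℕ) :
    Measurable (correlationFn μ (gcInitial (Euclidean.geometry d) ε μ f₀) s) := by
  have ham : ∀ p : ℕ, Measurable fun Zs : Config s d (EuclideanSpace ℝ d) =>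
      ((Nat.factorial p : ℕ) : ℝ)⁻¹ * marginal s p (gcInitial (Euclidean.geometry d) ε μ f₀ (s + p)) Zs := fun p =>
    (measurable_marginal s p (measurable_gcInitial_euclidean ε μ hf₀m (s + p))).const_mul _
  have hsum : Measurable fun Zs : Config s d (EuclideanSpace ℝ d) =>
      ∑' p : ℕ, ((Nat.factorial p : ℕ) : ℝ)⁻¹ * marginal s p (gcInitial (Euclidean.geometry d) ε μ f₀ (s + p)) Zs :=
    Measurable.tsum ham
  exact hsum.const_mul _

/-- The good-set restrictions of the initial correlation functions of the rare cloud are nice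
(measurable and Gaussian-bounded, `Kinetic.IsNice`): `|1_{good} F₀^{(m)}| ≤ c^m e^{-β₀ E}`
(`abs_correlationFn_gcInitial_le_dispersive`). [folklore] -/
theorem isNice_indicator_correlationFn_gcInitial (Φ : (s : ℕ) → HardSphereFlow (Euclidean.geometry d) ε s)
    {β₀ c μ : ℝ} (hβ₀ : 0 < β₀) (hμ : 0 ≤ μ) {f₀ : EuclideanSpace ℝ d × EuclideanSpace ℝ d → ℝ}
    (hf₀c : Continuous f₀) (hf₀nn : ∀ z, 0 ≤ f₀ z)
    (hf₀b : ∀ x v, f₀ (x, v) ≤ c * exp (-(β₀ / 2) * (‖x‖ ^ 2 + ‖v‖ ^ 2))) (m : ℕ) :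
    IsNice ((Φ m).good.indicator (correlationFn μ (gcInitial (Euclidean.geometry d) ε μ f₀) m)) := by
  refine ⟨(measurable_correlationFn_gcInitial_euclidean ε μ hf₀c.measurable m).indicator
    (Φ m).measurableSet_good, c ^ m, β₀, hβ₀, fun Z => ?_⟩
  have h := abs_correlationFn_gcInitial_le_dispersive (ε := ε) hμ hβ₀ hf₀c hf₀nn hf₀b m Z
  have hind : |(Φ m).good.indicator (correlationFn μ (gcInitial (Euclidean.geometry d) ε μ f₀) m) Z| ≤
      |correlationFn μ (gcInitial (Euclidean.geometry d) ε μ f₀) m Z| := by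
    by_cases hZ : Z ∈ (Φ m).good
    · rw [Set.indicator_of_mem hZ]
    · rw [Set.indicator_of_notMem hZ, abs_zero]; exact abs_nonneg _
  refine hind.trans (h.trans ?_)
  have h1 : exp (-(β₀ / 2) * ∑ j, ‖(Z j).1‖ ^ 2) ≤ 1 :=
    exp_le_one_iff.2 (mul_nonpos_of_nonpos_of_nonneg (by linarith)
      (Finset.sum_nonneg fun j _ => by positivity))
  have hcm : 0 ≤ c ^ m := by
    rcases m.eq_zero_or_pos with hm | hm
    · subst hm; simp
    · have hc : 0 ≤ c := by
        have := (hf₀nn (0, 0)).trans (hf₀b 0 0)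
        have he : 0 < exp (-(β₀ / 2) * (‖(0 : EuclideanSpace ℝ d)‖ ^ 2 + ‖(0 : EuclideanSpace ℝ d)‖ ^ 2)) :=
          exp_pos _
        nlinarith
      exact pow_nonneg hc m
  calc c ^ m * (exp (-(β₀ / 2) * ∑ j, ‖(Z j).1‖ ^ 2) * exp (-β₀ * configEnergy Z))
      ≤ c ^ m * (1 * exp (-β₀ * configEnergy Z)) := by gcongr
    _ = c ^ m * exp (-β₀ * configEnergy Z) := by rw [one_mul]

/-- **The Duhamel terms of the grand-canonical BBGKY hierarchy of the rare cloud on `ℝ^d` are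
measurable** (at every order, level and time `t ≥ 0`): they are Duhamel terms of the model
`liftedGCModel` applied to nice data (`liftedDuhamelTerm_eq_model`, `isNice_duhamelTerm`).
[folklore] -/
theorem measurable_gcDuhamelTerm (Φ : (s : ℕ) → HardSphereFlow (Euclidean.geometry d) ε s)
    {β₀ c μ : ℝ} (hβ₀ : 0 < β₀) (hμ : 0 ≤ μ) {f₀ : EuclideanSpace ℝ d × EuclideanSpace ℝ d → ℝ}
    (hf₀c : Continuous f₀) (hf₀nn : ∀ z, 0 ≤ f₀ z)
    (hf₀b : ∀ x v, f₀ (x, v) ≤ c * exp (-(β₀ / 2) * (‖x‖ ^ 2 + ‖v‖ ^ 2))) (n s : ℕ) {t : ℝ}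
    (ht : 0 ≤ t) :
    Measurable (duhamelTerm (fun m t' g => boundaryLift (Euclidean.geometry d) ε m
        ((Φ m).good.indicator (hsTransport (Φ m) t' g)))
      (fun m g W => ∑ i : Fin m, hsCollisionTerm (Euclidean.geometry d) ε m i g W) n s t
      (fun m => correlationFn μ (gcInitial (Euclidean.geometry d) ε μ f₀) m)) := by
  rw [liftedDuhamelTerm_eq_model Φ _ n s t]
  exact (isNice_duhamelTerm (liftedGCModel ε Φ)
    (fun m => isNice_indicator_correlationFn_gcInitial Φ hβ₀ hμ hf₀c hf₀nn hf₀b m) n s ht).1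

end Data

/-! ## §4. `illner_pulvirenti` from the identification and the term-by-term convergence of the
grand-canonical BBGKY series on `ℝ^d` -/

section Reduction

/-- **Illner–Pulvirenti's theorem from the two remaining inputs on its own Duhamel series** (CIP
1994 Thm 4.5.1, proof; the reduction `illner_pulvirenti_of_bbgkySide` with the functions
`A_k^{(s),n}(t)` specialised to the honest Duhamel terms `Q^{ε_k}_{s,s+n}(t) F_k(0)` of the
grand-canonical BBGKY hierarchy on `ℝ^d` — lifted good-set transports along the given flows,
operators `∑_i C^i_{m,m+1,ε_k}`, data the initial rescaled correlation functions — whose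
measurability (`measurable_gcDuhamelTerm`) and global majorants `(1 + e^{s-1}) c^s (c C_g)ⁿ e^{-(β₀/2) E}`
(`abs_gcDuhamelTerm_le_global`, CIP (5.9)) are PROVED). Suppose that for `d ∈ {2, 3}` and every
`β₀ > 0` there is a threshold `c_B > 0` such that for every continuous datum
`0 ≤ f₀ ≤ c_B e^{-(β₀/2)(|x|² + |v|²)}`, every horizon `T > 0`, every `ε_k → 0⁺` and all hard-sphere
flows `Φ k N` on `ℝ^d`, there are hard-sphere flows `Ψ k m` (the flows along which the series is
built: `Φ` itself, or a reference flow agreeing with it almost everywhere — any two hard-sphere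
flows do, and the freedom absorbs the null sets on which a given good set may be unnaturally
small) with:
(a) *the series represents the correlation functions* — for every `k`, `s` and `t ∈ [0, T]`,
`∑_n Q^{ε_k}_{s,s+n}(t) F_k(0) = F_k^{(s)}(t)` almost everywhere, the terms built along `Ψ k` and
`F_k^{(s)}(t)` the rescaled correlation functions of the grand-canonical state evolved by `Φ k`
(the rigorous BBGKY hierarchy and its iteration: CIP 1994 Thm 4.3.1, (4.7), App. 4.A–4.B;
Illner–Pulvirenti, Transport Theory Statist. Phys. 16 (1987)); and
(b) *term-by-term convergence* — each `Q^{ε_k}_{s,s+n}(t) F_k(0)` (built along `Ψ k`) converges to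
`Q⁰_{s,s+n}(t) f₀^{⊗(s+n)}` in the sense of observables, locally uniformly off the diagonal,
uniformly on `[0, T]` (CIP §4.4 Step 1, pp. 77–83; GST 2013 Part III).
Then `illner_pulvirenti` (hilbert6.S03) holds. [cite: CIP1994, §4.5 Thm 4.5.1, proof, pp. 88–90] -/
theorem illner_pulvirenti_of_gcSeries
    (h : ∀ (_hd : Fintype.card d = 2 ∨ Fintype.card d = 3) {β₀ : ℝ}, 0 < β₀ →
      ∃ c_B > (0 : ℝ), ∀ f₀ : EuclideanSpace ℝ d → EuclideanSpace ℝ d → ℝ,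
        Continuous (uncurry f₀) →
        (∀ x v, 0 ≤ f₀ x v ∧ f₀ x v ≤ c_B * exp (-(β₀ / 2) * (‖x‖ ^ 2 + ‖v‖ ^ 2))) →
        ∀ T > (0 : ℝ), ∀ ε : ℕ → ℝ, (∀ k, 0 < ε k) → Tendsto ε atTop (𝓝 0) →
          ∀ Φ : (k N : ℕ) → HardSphereFlow (Euclidean.geometry d) (ε k) N,
            ∃ Ψ : (k m : ℕ) → HardSphereFlow (Euclidean.geometry d) (ε k) m,
            (∀ k s, ∀ t ∈ Icc 0 T,
              (fun Z => ∑' n, duhamelTerm (fun m t' g => boundaryLift (Euclidean.geometry d) (ε k) m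
                    ((Ψ k m).good.indicator (hsTransport (Ψ k m) t' g)))
                  (fun m g W => ∑ i : Fin m, hsCollisionTerm (Euclidean.geometry d) (ε k) m i g W) n s t
                  (fun m => correlationFn (bgActivity d (ε k))
                    (gcInitial (Euclidean.geometry d) (ε k) (bgActivity d (ε k)) (uncurry f₀)) m) Z)
                =ᵐ[volume]
                correlationFn (bgActivity d (ε k))
                  (gcEvolved (Φ k) (gcInitial (Euclidean.geometry d) (ε k) (bgActivity d (ε k))
                    (uncurry f₀)) t) s) ∧
            (∀ (s n : ℕ) (ψ : (Fin s → EuclideanSpace ℝ d) → ℝ), Continuous ψ → HasCompactSupport ψ →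
              ∀ K ⊆ offDiag (X := EuclideanSpace ℝ d) s, IsCompact K → ∀ δ > (0 : ℝ),
                ∀ᶠ k in atTop, ∀ t ∈ Icc 0 T, ∀ xs ∈ K,
                  |velocityAverage ψ
                      (duhamelTerm (fun m t' g => boundaryLift (Euclidean.geometry d) (ε k) m
                          ((Ψ k m).good.indicator (hsTransport (Ψ k m) t' g)))
                        (fun m g W => ∑ i : Fin m, hsCollisionTerm (Euclidean.geometry d) (ε k) m i g W)
                        n s t
                        (fun m => correlationFn (bgActivity d (ε k))
                          (gcInitial (Euclidean.geometry d) (ε k) (bgActivity d (ε k)) (uncurry f₀)) m)) xs -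
                    velocityAverage ψ (boltzmannDuhamelTerm (Euclidean.geometry d) n s t
                      (fun j => tensorPow j (uncurry f₀))) xs| ≤ δ)) :
    illner_pulvirenti (d := d) := by
  refine illner_pulvirenti_of_bbgkySide fun hd β₀ hβ₀ => ?_
  have hd2 : 2 ≤ Fintype.card d := by rcases hd with h2 | h3 <;> omega
  obtain ⟨c_B, hc_B, hB⟩ := h hd hβ₀
  -- the global series constant
  obtain ⟨Cg, hCg⟩ : ∃ Cg : ℝ, Cg =
      exp 2 * (sqrt 2 ^ (Fintype.card d + 3) / sqrt β₀ ^ (Fintype.card d + 1)) *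
        ((KineticTheory.sphereMeasure : Measure (sphere (0 : EuclideanSpace ℝ d) 1)).real univ *
          (2 ^ Fintype.card d *
            (2 ^ Fintype.card d * (∫ w : EuclideanSpace ℝ d, exp (-‖w‖ ^ 2)) +
              sqrt β₀ ^ Fintype.card d * ∫ w : EuclideanSpace ℝ d, exp (-(β₀ / 2) * ‖w‖ ^ 2)))) :=
    ⟨_, rfl⟩
  have hCg0 : 0 ≤ Cg := by
    have h1 : 0 ≤ ∫ w : EuclideanSpace ℝ d, exp (-‖w‖ ^ 2) := integral_nonneg fun w => (exp_pos _).le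
    have h2 : 0 ≤ ∫ w : EuclideanSpace ℝ d, exp (-(β₀ / 2) * ‖w‖ ^ 2) :=
      integral_nonneg fun w => (exp_pos _).le
    have h3 : (0 : ℝ) ≤ (KineticTheory.sphereMeasure : Measure (sphere (0 : EuclideanSpace ℝ d) 1)).real univ :=
      measureReal_nonneg
    rw [hCg]
    positivity
  -- the threshold: also `4 c Cg ≤ 1`
  set c : ℝ := min c_B (1 / (4 * Cg + 1)) with hc
  have hcpos : 0 < c := lt_min hc_B (by positivity)
  have hccB : c ≤ c_B := min_le_left _ _
  have hcCg : c * Cg ≤ 4⁻¹ := by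
    have h1 : c ≤ 1 / (4 * Cg + 1) := min_le_right _ _
    have h2 : c * (4 * Cg + 1) ≤ 1 := by
      rw [le_div_iff₀ (by positivity)] at h1
      exact h1
    nlinarith [hcpos.le]
  refine ⟨c, hcpos, fun f₀ hf₀c hf₀b T hT ε hε hε0 Φ => ?_⟩
  have hf₀bB : ∀ x v, 0 ≤ f₀ x v ∧ f₀ x v ≤ c_B * exp (-(β₀ / 2) * (‖x‖ ^ 2 + ‖v‖ ^ 2)) :=
    fun x v => ⟨(hf₀b x v).1, (hf₀b x v).2.trans (mul_le_mul_of_nonneg_right hccB (exp_pos _).le)⟩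
  obtain ⟨Ψ, hrepr, hconv⟩ := hB f₀ hf₀c hf₀bB T hT ε hε hε0 Φ
  have hf₀nn : ∀ z : EuclideanSpace ℝ d × EuclideanSpace ℝ d, 0 ≤ uncurry f₀ z := fun z => (hf₀b z.1 z.2).1
  have hf₀b' : ∀ x v, uncurry f₀ (x, v) ≤ c * exp (-(β₀ / 2) * (‖x‖ ^ 2 + ‖v‖ ^ 2)) :=
    fun x v => (hf₀b x v).2
  have hμ : ∀ k, 0 ≤ bgActivity d (ε k) := fun k => by
    unfold bgActivity
    have := (hε k).le
    positivity
  refine ⟨fun k s n t => duhamelTerm (fun m t' g => boundaryLift (Euclidean.geometry d) (ε k) m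
      ((Ψ k m).good.indicator (hsTransport (Ψ k m) t' g)))
    (fun m g W => ∑ i : Fin m, hsCollisionTerm (Euclidean.geometry d) (ε k) m i g W) n s t
    (fun m => correlationFn (bgActivity d (ε k))
      (gcInitial (Euclidean.geometry d) (ε k) (bgActivity d (ε k)) (uncurry f₀)) m),
    fun s => (1 + exp (s - 1 : ℝ)) * c ^ s, 4⁻¹, β₀ / 2, by norm_num, by norm_num, half_pos hβ₀,
    ?_, ?_, hrepr, hconv⟩
  · intro k s n t ht
    exact measurable_gcDuhamelTerm (Ψ k) hβ₀ (hμ k) hf₀c hf₀nn hf₀b' n s ht.1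
  · intro k s n t ht Z
    have hmaj := abs_gcDuhamelTerm_le_global hd2 (hε k).le (Ψ k) hβ₀ hcpos.le (hμ k) hf₀c hf₀nn
      hf₀b' s n ht.1 Z
    rw [← hCg] at hmaj
    refine hmaj.trans ?_
    have h1 : (c * Cg) ^ n ≤ 4⁻¹ ^ n := pow_le_pow_left₀ (mul_nonneg hcpos.le hCg0) hcCg n
    have h2 : 0 ≤ (1 + exp (s - 1 : ℝ)) * c ^ s := by positivity
    gcongr

end Reduction

end

end Literature.MathematicalPhysics.KineticTheory
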